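import Summits.NavierStokesRegularity.OSWSelfSimilar.SheetRSpectrumCertifiedProfile
import Summits.NavierStokesRegularity.OSWSelfSimilar.SheetRCentreOfRecordValue
import Summits.NavierStokesRegularity.OSWSelfSimilar.SheetRLiftOfRecord
import HarnessLib

/-!
# SHEET-ℝ frame: EXISTENCE ∘ SPECTRUM for the CENTRE AND LIFT OF RECORD — `certifiedProfile_word` with hypothesis-ledger rows #1, #2, #9, #13, #14
# DISCHARGED by the typed objects

HONEST FRAMING (cell ns-blowup GROUP B / zone Z3, cases Z3-SR-CERT + Z3-SR-SPEC; 1-D MODEL certificate (viscous gCLM/OSW sheet on the line at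
`(a, c_l, ε) = (1/5, 1/2, 1)`); computer-assisted; not Euler/NS; «violates: none — MODEL»).  cert-2 g8's `SheetRSpectrumCertifiedProfile.certifiedProfile_word`
is the packaged MODEL theorem «NK certificate + S1/S2 spectral certificate ⇒ ∃! δ, Ω* = Ω̄ + δ is a centre whose odd-class linearisation has weak
point spectrum {1} in Re σ > −3/100», with 14 named hypotheses (HYPOTHESIS-LEDGER.md a093d529dfc6ca79).  Five of them concern only WHICH centre `Ω̄` and
WHICH lift `h` are meant: #1 `hc : IsCentre 8 Ω̄ Ω̄₁ H₀`, #2 `hΩ₁ : ContDiff ℝ 1 Ω̄₁`, #9 `hX₀ : (√2/8)·rEBR2 < |Ω̄(X₀)|`, #14 `hh : h ∈ Wodd 8`,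
#13 `hhw : ‖h + 0i‖² ≤ hw2`.  With the TYPED centre of record (`SheetRCentreOfRecord.centreOfRecord`, = cert-1's JSON centre by
`SheetRCentreOfRecordSine.centreOfRecord_eq_sineForm`) and the TYPED lift of record (`SheetRLiftOfRecord.liftOfRecord`, the 12 float64 dyadics of the
spectral stage) these five are KERNEL FACTS (`isCentre_centreOfRecord`, `contDiff_centreOfRecordDeriv`, `rEBR2_lt_abs_centreOfRecord_eight` at `X₀ = 8`,
`liftOfRecord_mem_Wodd`, `norm_sq_ofRealW_liftOfRecord_le`), and this file states the word FOR THE OBJECTS OF RECORD with exactly the NINE remaining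
hypotheses — all of them interval-arithmetic sentences of record ABOUT DEFINED OBJECTS: (C1) pointwise datum #3, the base solution operator #4 (exists
under #3, kernel), the capacitance inverse #5 and its bounds #6/#7, the residual #8, the (S1) Gårding datum #10, the point records #11, the mixed far
datum #12.  No definition, no named fact; a one-line instantiation.  WHAT THIS IS NOT: not NS; no interval sentence is proved here; «a certified
MODEL profile is not an NS blow-up».
-/

noncomputable section

namespace Summit.NavierStokesRegularity.OSWSelfSimilar
namespace SheetRCertifiedProfileOfRecord

open _root_.MeasureTheory _root_.Set _root_.Filter _root_.Real _root_.Metric Literature.Analysis.Fourier SheetRWeakProfilePV SheetRWeakToStrong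
  SheetREnergyClass SheetRWeightedMeasure SheetREnergySpace SheetRLinearisedTests SheetRTestSpace SheetRLinearisedFormBounds
  SheetRSolutionOperator SheetRComplexPivot SheetRAssemblyOperators SheetRCertificateAssembly SheetRGeneratorOddWeak SheetROddClass
  SheetRResolventOddClass SheetREvansOdd SheetRSpectrumWindingLists SheetRSpectrumOddAssembly SheetRSpectrumOddAssemblyReal SheetRWeakEigenReal
  SheetRPerturbedResolventC SheetRLinearisationPerturbation SheetRTimeShiftModeWeak SheetRTimeShiftModeWeakEigen SheetRCentreReencoding
  SheetRSpectrumStepRule SheetRSpectrumPointCertificate SheetRResolventConj SheetRSpectrumPointAssembly SheetRSpectrumEndToEnd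
  SheetRSpectrumPointEndToEnd SheetRCertificateWeakZero SheetRCertificateCoercivity SheetRCertificateAssemblyB SheetRSpectrumCertifiedProfile
  SheetRFrameCentre SheetRCentreOfRecord SheetRCentreOfRecordValue SheetRLiftOfRecord
  Literature.Analysis.OperatorTheory Complex CertificateViscousSheetR Matrix Finset
open scoped Topology ENNReal InnerProductSpace ContDiff BigOperators

/-- **EXISTENCE ∘ SPECTRUM FOR THE CENTRE AND LIFT OF RECORD.**  `certifiedProfile_word` with `Ω̄ := centreOfRecord` (the typed centre, = cert-1's
`centre_L8_refit_rational.json` c4de65e13d80c930), `Ω̄₁ := centreOfRecordDeriv`, `X₀ := 8`, `h := liftOfRecord` (the 12-mode lift of the spectral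
stage): hypothesis-ledger rows #1, #2, #9, #13, #14 are discharged by kernel facts, and the NINE remaining hypotheses are the interval sentences of record
— now statements about DEFINED objects.  Conclusion verbatim: ∃! δ in the `rEBR2`-ball solving the linearised weak equation at `Ω̄`, and for
`Ω* = Ω̄ + prim (der δ)` (a centre) «{σ : Re σ > −3/100 ∧ −DG(Ω*)|odd has a non-trivial weak eigenvector at σ} = {1}».  MODEL statement; not NS. [folklore] -/
theorem certifiedProfile_word_ofRecord
    (hC1 : ∀ ξ, ((8:ℝ) ^ 2 + ξ ^ 2) / 2 + 1 + ξ ^ 2 / 2 + 1 / 5 * ξ * (∫ s in (0 : ℝ)..ξ, hilbertTransform centreOfRecord s)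
      + (1 / 5) / 2 * ((8:ℝ) ^ 2 + ξ ^ 2) * hilbertTransform centreOfRecord ξ ≤ ((8:ℝ) ^ 2 + ξ ^ 2) * potential 8 4 centreOfRecord ξ)
    (S₀ : W 8 →L[ℝ] Esp 8 eight_pos)
    (hS₀ : ∀ (g : W 8) (v v₁ : ℝ → ℝ), IsCompactTest v v₁ →
      linForm 8 (drift (1 / 5) centreOfRecord) (potential 8 4 centreOfRecord) (prim (der (S₀ g))) (der (S₀ g)) v v₁
        = ∫ y, ((8:ℝ) ^ 2 + y ^ 2) * ((g : ℝ → ℝ) y * v y))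
    {n : ℕ} (f : Fin n → W 8) (ℓ : Fin n → Esp 8 eight_pos →L[ℝ] ℝ) (Nmat : Matrix (Fin n) (Fin n) ℝ)
    (hN₁ : (1 - capMatrix (fun i => S₀ (f i)) ℓ) * Nmat = 1) (hN₂ : Nmat * (1 - capMatrix (fun i => S₀ (f i)) ℓ) = 1)
    (hKNwB : ∀ g : W 8, ‖capInverse (fun i => S₀ (f i)) ℓ Nmat (S₀ g)‖ ≤ (KNwB : ℝ) * ‖g‖)
    (hepsNB : ∀ u : Esp 8 eight_pos, ‖PopC eight_pos 4 (1 / 5) isCentre_centreOfRecord u - ∑ i, ℓ i u • f i‖ ≤ (epsNBR : ℝ) * ‖u‖)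
    (hG : Integrable fun y => ((8:ℝ) ^ 2 + y ^ 2) * (centreOfRecord y + 1 / 2 * y * centreOfRecordDeriv y
      + 1 / 5 * (∫ s in (0 : ℝ)..y, hilbertTransform centreOfRecord s) * centreOfRecordDeriv y
      - hilbertTransform centreOfRecord y * centreOfRecord y - deriv centreOfRecordDeriv y) ^ 2)
    (hηB : Real.sqrt (∫ y, ((8:ℝ) ^ 2 + y ^ 2) * (centreOfRecord y + 1 / 2 * y * centreOfRecordDeriv y
      + 1 / 5 * (∫ s in (0 : ℝ)..y, hilbertTransform centreOfRecord s) * centreOfRecordDeriv y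
      - hilbertTransform centreOfRecord y * centreOfRecord y - deriv centreOfRecordDeriv y) ^ 2) ≤ (etaB2 : ℝ))
    {D₀ D₁ V₀ : ℝ}
    (hS1 : GardingDataKC 8 eight_pos (drift (1 / 5) centreOfRecord) (potential 8 4 centreOfRecord)
      (-PopC eight_pos 4 (1 / 5) isCentre_centreOfRecord + ((4 : ℝ) • ((innerSL ℝ liftOfRecord).comp (ιE eight_pos))).smulRight liftOfRecord)
      D₀ D₁ V₀ (1 / 5) (3 / 20))
    (hPD : PointData (resolventKC eight_pos _ hS1) (ofRealW 8 liftOfRecord) (ofRealW 8 liftOfRecord) 4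
      (evansOdd eight_pos _ hS1 ((innerSL ℂ (ofRealW 8 liftOfRecord)).comp (Wcodd 8).subtypeL) (realOdd liftOfRecord liftOfRecord_mem_Wodd) 4))
    (hFD : MixedFarDatum (resolventKC eight_pos _ hS1) (ofRealW 8 liftOfRecord) (ofRealW 8 liftOfRecord) 1 ((3593635617 : ℝ) / 5000000000)
      ((331182857 : ℝ) / 250000000) ((802337581 : ℝ) / 500000000) ((1710547133 : ℝ) / 1000000000)) :
    ∃ δ : Esp 8 eight_pos, δ ∈ closedBall (0 : Esp 8 eight_pos) (rEBR2 : ℝ) ∧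
      (∀ v v₁ : ℝ → ℝ, IsCompactTest v v₁ →
        linForm 8 (drift (1 / 5) centreOfRecord) (potential 8 4 centreOfRecord) (prim (der δ)) (der δ) v v₁ =
          ∫ y, ((8:ℝ) ^ 2 + y ^ 2) * ((PopFun 8 4 (1 / 5) centreOfRecord centreOfRecordDeriv δ y
            - (centreOfRecord y + 1 / 2 * y * centreOfRecordDeriv y
              + 1 / 5 * (∫ s in (0 : ℝ)..y, hilbertTransform centreOfRecord s) * centreOfRecordDeriv y
              - hilbertTransform centreOfRecord y * centreOfRecord y - deriv centreOfRecordDeriv y)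
            - QFun 8 (1 / 5) δ δ y) * v y)) ∧
      (∀ δ' ∈ closedBall (0 : Esp 8 eight_pos) (rEBR2 : ℝ),
        (∀ v v₁ : ℝ → ℝ, IsCompactTest v v₁ →
          linForm 8 (drift (1 / 5) centreOfRecord) (potential 8 4 centreOfRecord) (prim (der δ')) (der δ') v v₁ =
            ∫ y, ((8:ℝ) ^ 2 + y ^ 2) * ((PopFun 8 4 (1 / 5) centreOfRecord centreOfRecordDeriv δ' y
              - (centreOfRecord y + 1 / 2 * y * centreOfRecordDeriv y
                + 1 / 5 * (∫ s in (0 : ℝ)..y, hilbertTransform centreOfRecord s) * centreOfRecordDeriv y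
                - hilbertTransform centreOfRecord y * centreOfRecord y - deriv centreOfRecordDeriv y)
              - QFun 8 (1 / 5) δ' δ' y) * v y)) → δ' = δ) ∧
      ∃ (Ωs₁ : ℝ → ℝ) (Hs : ℝ) (hcs : IsCentre 8 (fun y => centreOfRecord y + prim (der δ) y) Ωs₁ Hs),
        {σ : ℂ | ra < σ.re ∧ ∃ w : Wcodd 8, w ≠ 0 ∧
          IsWeakEigen eight_pos (-PopC eight_pos 4 (1 / 5) hcs + ((4 : ℝ) • ((innerSL ℝ liftOfRecord).comp (ιE eight_pos))).smulRight liftOfRecord)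
            (drift (1 / 5) (fun y => centreOfRecord y + prim (der δ) y)) (potential 8 4 (fun y => centreOfRecord y + prim (der δ) y))
            ((innerSL ℂ (ofRealW 8 liftOfRecord)).comp (Wcodd 8).subtypeL) (realOdd liftOfRecord liftOfRecord_mem_Wodd) 4 σ w} = {1} :=
  certifiedProfile_word isCentre_centreOfRecord (contDiff_centreOfRecordDeriv (k := 1)) hC1 S₀ hS₀ f ℓ Nmat hN₁ hN₂ hKNwB hepsNB hG hηB
    rEBR2_lt_abs_centreOfRecord_eight liftOfRecord liftOfRecord_mem_Wodd hS1 hPD hFD norm_sq_ofRealW_liftOfRecord_le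

end SheetRCertifiedProfileOfRecord
end Summit.NavierStokesRegularity.OSWSelfSimilar

end
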